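import Summits.CriticalPhenomena.PercolationContinuityZ3.Theorems.PercNearOneGluingNoHeavyQuantFarK5Cert
import Literature.Probability.LatticeModels.ProdBernoulliClusterLocality
import HarnessLib

/-!
# FAR (`Quant.FarRelayRow`) two-copy certificates on a SUPPORT: weights vanishing off an edge list

builds on p205010 (kernel theorem, internal audit signed; external expert review pending)

Support file (`--supports stmt-CriticalPhenomena-4575`), seat `prim-cert-1` (gen 18).  QUANT lane rung R8, front "FAR beyond trees"
(lead g20, 2026-08-21): `Quant.FarRelayRow` on weight functions whose SUPPORT is a sparse graph (unicyclic graphs, rings with hairs).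
The two-copy machinery of `…TwoCopyFibre` / `…TwoCopyExpansion` / `…QuantFarK5Cert` proves FAR instances from bidegree-2 Bernstein
certificates on the COMPLETE list of pairs `allPairs n` (every weight free).  A certificate on the `m = |E(G)|` coordinates of a sparse
graph `G` is a much smaller object, but it only controls weight functions VANISHING OFF `G`.  This file is the measure-side bridge:

* `TwoCopy.VanishesOff w es` — every non-loop pair outside `Eset es` has weight `0`.
* `TwoCopy.ae_openGraph_eq_inter` — then almost surely the open graph of `ω` is the open graph of `ω ∩ Eset es`
  (`prodBernoulli_ae_forall_notMem`), so
* `TwoCopy.prodBernoulli_real_eq_ex_of_vanish` — **`P_w(D) = E_w[1_D]` over the `2^m` configurations of `es`** for every event `D`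
  read off the open graph (`prodBernoulli_real_eq_ex` applied to the `Eset es`-determined event `{ω | ω ∩ Eset es ∈ D}`);
* `ex_connB_on`, `ex_notConnB_on`, `ex_leLayer_on`, `ex_relayCount_on`, `ex_hF_on`, `ex_tF_on` — the expectations of the FAR tables
  `tF n es As o j`, `hF n es As o j` (of `…QuantFarK5Cert`, which are already stated for an arbitrary edge list) are the probabilities;
* `TwoCopy.farLayer_le_of_check_on` — a passed `twoCopyCheck` on the coordinates of `es` (with a multiplier `a ≢ 0`) gives the FAR
  conclusion for every `w` vanishing off `es` with all `es`-weights in `(0,1)`, under `2j ≤ Σ P(o ↔ v)`;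
* `TwoCopy.FARp.of_check_on` — **hence `FARp w A o j` for EVERY `w` vanishing off `es`** (closed cube on `es`: the sequence
  `nudge k` on the pairs of `Eset es`, `w` elsewhere, is eventually in the open `es`-cube and converges to `w`; `FARp.of_limit`);
* `TwoCopy.FARp.of_deep_on` — the hypothesis-free "deep relay" instances: if in every configuration of `es` in which `o ↔ v`
  (`v` a listed relay) at least `j + 1` relays are joined to `o` (`deepCheck`, a finite check), then `{N ≤ j} ⊆ {o ↮ v}` a.s. and
  `FARp w A o j` for every `w` vanishing off `es` — e.g. the MEDIAN relay of a bare ring, which makes FAR on bare rings trivial.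

No sorries; standard axioms; nothing computational; nothing asserts `FarRelayRow` itself.
[cite: KozmaNitzan2024, Lemma 2 (p. 6), Conjecture 3 (p. 15)] (context: the lower-tail family; FAR is this programme's statement);
[cite: Grimmett1999, §1.3 p. 10; §2.2] (product measure; events determined by finitely many edges).
-/

namespace Summit.CriticalPhenomena.PercolationContinuityZ3.Theorems.TwoCopy

open Finset MeasureTheory Filter Topology
open Literature.Probability.Percolation Literature.Probability.LatticeModels
open Summit.CriticalPhenomena.PercolationContinuityZ3.Theorems.AdditiveGluing.Negative.Cert
open scoped Classical

/-! ## Weights vanishing off a support -/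

/-- The weight function `w` VANISHES OFF the edge list `es`: every non-loop pair outside `Eset es` has weight `0`
(loops never matter for the open graph). [this work] -/
def VanishesOff {n : ℕ} (w : Sym2 (Fin n) → unitInterval) (es : List (Fin n × Fin n)) : Prop :=
  ∀ e : Sym2 (Fin n), ¬ e.IsDiag → e ∉ Eset es → w e = 0

/-- Two configurations with the same open non-loop pairs have the same open graph. [folklore] -/
theorem openGraph_eq_of_forall {n : ℕ} {ω ω' : Set (Sym2 (Fin n))}
    (h : ∀ x y : Fin n, x ≠ y → (s(x, y) ∈ ω ↔ s(x, y) ∈ ω')) : openGraph ω = openGraph ω' := by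
  ext x y
  simp only [openGraph_adj]
  constructor
  · rintro ⟨hm, hne⟩; exact ⟨(h x y hne).1 hm, hne⟩
  · rintro ⟨hm, hne⟩; exact ⟨(h x y hne).2 hm, hne⟩

/-- **Almost surely the open graph lives on the support.**  If `w` vanishes off `es` then for `P_w`-a.e. `ω`,
`openGraph ω = openGraph (ω ∩ Eset es)`. [this work] -/
theorem ae_openGraph_eq_inter {n : ℕ} (w : Sym2 (Fin n) → unitInterval) (es : List (Fin n × Fin n))
    (hw : VanishesOff w es) :
    ∀ᵐ ω ∂(prodBernoulli w), openGraph ω = openGraph (ω ∩ (↑(Eset es) : Set (Sym2 (Fin n)))) := by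
  have hZ : ∀ e ∈ {e : Sym2 (Fin n) | ¬ e.IsDiag ∧ e ∉ Eset es}, w e = 0 := fun e he => hw e he.1 he.2
  filter_upwards [prodBernoulli_ae_forall_notMem w (Set.to_countable _) hZ] with ω hω
  refine openGraph_eq_of_forall fun x y hxy => ⟨fun hm => ⟨hm, ?_⟩, fun hm => hm.1⟩
  by_contra hE
  exact hω s(x, y) ⟨by rwa [Sym2.mk_isDiag_iff], hE⟩ hm

/-- The edge set of a picked sub-list lies in the edge set of the list. [this work] -/
theorem Eset_pick_subset {n : ℕ} (es : List (Fin n × Fin n)) (c : ℕ) : Eset (pick es c) ⊆ Eset es := by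
  intro e he
  unfold Eset at he ⊢
  rw [List.mem_toFinset] at he ⊢
  exact ((pick_sublist es c).map mkE).subset he

/-- **`P_w(D) = E_w[1_D]` on a support.**  For `w` vanishing off `es` (distinct unordered pairs) and an event `D` read off the
open graph: the probability of `D` is the `wt`-weighted count of the configurations `c < 2^m` of `es` with `Eset (pick es c) ∈ D`.
[this work] -/
theorem prodBernoulli_real_eq_ex_of_vanish {n : ℕ} (w : Sym2 (Fin n) → unitInterval) (es : List (Fin n × Fin n))
    (hnd : (es.map mkE).Nodup) (hw : VanishesOff w es) (D : Set (Set (Sym2 (Fin n))))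
    (hD : ∀ ω ω' : Set (Sym2 (Fin n)), openGraph ω = openGraph ω' → (ω ∈ D ↔ ω' ∈ D)) :
    (prodBernoulli w).real D =
      ex es.length (wN w es) (fun c => if (↑(Eset (pick es c)) : Set (Sym2 (Fin n))) ∈ D then 1 else 0) := by
  classical
  set E : Set (Sym2 (Fin n)) := ↑(Eset es) with hE
  set D' : Set (Set (Sym2 (Fin n))) := {ω | ω ∩ E ∈ D} with hD'
  have hdet : DeterminedBy D' E := by
    rw [determinedBy_iff]
    intro ω ω' h
    simp only [hD', Set.mem_setOf_eq, h]
  have hae : D =ᵐ[prodBernoulli w] D' := by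
    filter_upwards [ae_openGraph_eq_inter w es hw] with ω hω
    simp only [hD', eq_iff_iff]
    exact hD ω (ω ∩ E) hω
  rw [measureReal_congr hae, prodBernoulli_real_eq_ex w es hnd D' hdet]
  refine sum_congr rfl fun c _ => ?_
  have hsub : (↑(Eset (pick es c)) : Set (Sym2 (Fin n))) ∩ E = ↑(Eset (pick es c)) :=
    Set.inter_eq_left.2 (by rw [hE]; exact_mod_cast Eset_pick_subset es c)
  simp only [hD', Set.mem_setOf_eq, hsub]

/-! ## Expectations of the FAR tables are probabilities (support version) -/

section Expect

variable {n : ℕ} (w : Sym2 (Fin n) → unitInterval) (es : List (Fin n × Fin n))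

/-- `E_w[1[u ↔ v]] = P_w(u ↔ v)` on a support. [this work] -/
theorem ex_connB_on (hnd : (es.map mkE).Nodup) (hw : VanishesOff w es) (u v : Fin n) :
    ex es.length (wN w es) (fun c => if connB n es c u v then 1 else 0) =
      (prodBernoulli w).real (openConn u v) := by
  rw [prodBernoulli_real_eq_ex_of_vanish w es hnd hw (openConn u v)
    (fun ω ω' h => by simp only [openConn, Set.mem_setOf_eq, h])]
  refine sum_congr rfl fun c _ => ?_
  dsimp only
  congr 1
  by_cases h : connB n es c u v = true
  · rw [if_pos h, if_pos ((connB_iff _ c u v).1 h)]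
  · rw [if_neg h, if_neg (fun h' => h ((connB_iff _ c u v).2 h'))]

/-- `E_w[1[u ↮ v]] = P_w((u ↔ v)ᶜ)` on a support. [this work] -/
theorem ex_notConnB_on (hnd : (es.map mkE).Nodup) (hw : VanishesOff w es) (u v : Fin n) :
    ex es.length (wN w es) (fun c => if connB n es c u v then 0 else 1) =
      (prodBernoulli w).real (openConn u v)ᶜ := by
  rw [prodBernoulli_real_eq_ex_of_vanish w es hnd hw (openConn u v)ᶜ
    (fun ω ω' h => by simp only [Set.mem_compl_iff, openConn, Set.mem_setOf_eq, h])]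
  refine sum_congr rfl fun c _ => ?_
  dsimp only
  congr 1
  by_cases h : connB n es c u v = true
  · rw [if_pos h, if_neg (fun h' : _ ∈ (openConn u v)ᶜ => h' ((connB_iff _ c u v).1 h))]
  · rw [if_neg h, if_pos (show _ ∈ (openConn u v)ᶜ from fun h' => h ((connB_iff _ c u v).2 h'))]

/-- `E_w[1[N ≤ j]] = P_w(N ≤ j)` on a support. [this work] -/
theorem ex_leLayer_on (hnd : (es.map mkE).Nodup) (hw : VanishesOff w es) {As : List (Fin n)} (hAs : As.Nodup)
    (o : Fin n) (j : ℕ) :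
    ex es.length (wN w es) (fun c => if relayCount n es As o c ≤ j then 1 else 0) =
      (prodBernoulli w).real {ω : Set (Sym2 (Fin n)) | (As.toFinset.filter fun a => ω ∈ openConn o a).card ≤ j} := by
  classical
  set D : Set (Set (Sym2 (Fin n))) := {ω | (As.toFinset.filter fun a => ω ∈ openConn o a).card ≤ j} with hDdef
  rw [prodBernoulli_real_eq_ex_of_vanish w es hnd hw D
    (fun ω ω' h => by simp only [hDdef, Set.mem_setOf_eq, openConn, h])]
  refine sum_congr rfl fun c _ => ?_
  dsimp only
  congr 1
  rw [relayCount_eq_card _ hAs o c]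
  simp only [hDdef, Set.mem_setOf_eq]

/-- `E_w[1[N ≤ j ∧ o ↔ v]] = P_w(N ≤ j, o ↔ v)` on a support. [this work] -/
theorem ex_leLayer_conn_on (hnd : (es.map mkE).Nodup) (hw : VanishesOff w es) {As : List (Fin n)} (hAs : As.Nodup)
    (o v : Fin n) (j : ℕ) :
    ex es.length (wN w es) (fun c => if relayCount n es As o c ≤ j ∧ connB n es c o v = true then 1 else 0) =
      (prodBernoulli w).real ({ω : Set (Sym2 (Fin n)) | (As.toFinset.filter fun a => ω ∈ openConn o a).card ≤ j} ∩
        openConn o v) := by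
  classical
  set D : Set (Set (Sym2 (Fin n))) := {ω | (As.toFinset.filter fun a => ω ∈ openConn o a).card ≤ j} ∩ openConn o v
    with hDdef
  rw [prodBernoulli_real_eq_ex_of_vanish w es hnd hw D
    (fun ω ω' h => by simp only [hDdef, Set.mem_inter_iff, Set.mem_setOf_eq, openConn, h])]
  refine sum_congr rfl fun c _ => ?_
  dsimp only
  congr 1
  rw [relayCount_eq_card _ hAs o c]
  simp only [hDdef, Set.mem_inter_iff, Set.mem_setOf_eq, connB_iff]

/-- `E_w[N] = Σ_{a ∈ A} P_w(o ↔ a)` on a support. [this work] -/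
theorem ex_relayCount_on (hnd : (es.map mkE).Nodup) (hw : VanishesOff w es) {As : List (Fin n)} (hAs : As.Nodup)
    (o : Fin n) :
    ex es.length (wN w es) (fun c => (relayCount n es As o c : ℝ)) =
      ∑ a ∈ As.toFinset, (prodBernoulli w).real (openConn o a) := by
  simp only [relayCount_eq_sum _ hAs]
  rw [ex_sum]
  exact sum_congr rfl fun a _ => ex_connB_on w es hnd hw o a

/-- `E_w[h] = Σ_{v ∈ A} P_w(o ↔ v) − 2j` on a support. [this work] -/
theorem ex_hF_on (hnd : (es.map mkE).Nodup) (hw : VanishesOff w es) {As : List (Fin n)} (hAs : As.Nodup)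
    (o : Fin n) (j : ℕ) :
    ex es.length (wN w es) (fun c => (hF n es As o j c : ℝ)) =
      (∑ a ∈ As.toFinset, (prodBernoulli w).real (openConn o a)) - 2 * j := by
  have h2 : ex es.length (wN w es) (fun _ => (2 * j : ℝ)) = 2 * j := by
    have := ex_const_mul es.length (wN w es) (2 * j) (fun _ => 1)
    simp only [mul_one] at this
    rw [this, ex_one w es hnd, mul_one]
  unfold hF
  push_cast
  rw [ex_sub, ex_relayCount_on w es hnd hw hAs o, h2]

/-- `E_w[t_i] = P_w(o ↮ v_i) − P_w(N ≤ j)` on a support. [this work] -/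
theorem ex_tF_on (hnd : (es.map mkE).Nodup) (hw : VanishesOff w es) {As : List (Fin n)} (hAs : As.Nodup)
    (o : Fin n) (j i : ℕ) :
    ex es.length (wN w es) (fun c => (tF n es As o j i c : ℝ)) =
      (prodBernoulli w).real (openConn o (As.getD i o))ᶜ -
      (prodBernoulli w).real {ω : Set (Sym2 (Fin n)) | (As.toFinset.filter fun a => ω ∈ openConn o a).card ≤ j} := by
  unfold tF
  push_cast
  rw [ex_sub, ex_notConnB_on w es hnd hw, ex_leLayer_on w es hnd hw hAs o j]

end Expect

/-! ## FAR on the open support-cube from a passed check -/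

/-- **A FAR instance from a two-copy certificate on a support, open `es`-cube.**  If the check passes for tables `t', h'`
agreeing with `tF n es, hF n es` below `2^m` (`m = |es|`, relay list of length `K`, layer `j`) and a multiplier `a` with a positive
entry, then for every weight function vanishing off `es` with all `es`-weights in `(0,1)`, `Σ_{v∈R} P(o ↔ v) ≥ 2j` and all cuts
`P(o ↮ v) ≤ t`: `P(N ≤ j) ≤ t`. [this work] -/
theorem farLayer_le_of_check_on {n : ℕ} (es : List (Fin n × Fin n)) (hnd : (es.map mkE).Nodup)
    {As : List (Fin n)} (hAs : As.Nodup) (o : Fin n) (j : ℕ) {K : ℕ} (hK : As.length = K)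
    {t' : ℕ → ℕ → ℤ} {h' : ℕ → ℤ} {a : ℕ → ℕ → ℕ} {b : ℕ → ℕ}
    (ht' : ∀ i < K, ∀ c < 2 ^ es.length, t' i c = tF n es As o j i c)
    (hh' : ∀ c < 2 ^ es.length, h' c = hF n es As o j c)
    (hc : twoCopyCheck es.length K t' h' a b = true)
    {i₀ c₀ : ℕ} (hi₀ : i₀ < K) (hc₀ : c₀ < 2 ^ es.length) (ha₀ : 0 < a i₀ c₀)
    (w : Sym2 (Fin n) → unitInterval) (hw : VanishesOff w es) (hopen : ∀ i < es.length, 0 < wN w es i ∧ wN w es i < 1)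
    (hEN : (2 * j : ℝ) ≤ ∑ x ∈ As.toFinset, (prodBernoulli w).real (openConn o x))
    (t : ℝ) (hcut : ∀ x ∈ As.toFinset, (prodBernoulli w).real (openConn o x)ᶜ ≤ t) :
    (prodBernoulli w).real {ω : Set (Sym2 (Fin n)) | (As.toFinset.filter fun x => ω ∈ openConn o x).card ≤ j} ≤ t := by
  classical
  set m := es.length with hm
  set L := (prodBernoulli w).real {ω : Set (Sym2 (Fin n)) | (As.toFinset.filter fun x => ω ∈ openConn o x).card ≤ j} with hL
  have hw01 : ∀ i, 0 ≤ wN w es i ∧ wN w es i ≤ 1 := fun i => wN_mem w es i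
  have hexh : ex m (wN w es) (fun c => (h' c : ℝ)) = ex m (wN w es) (fun c => (hF n es As o j c : ℝ)) := by
    unfold ex
    exact sum_congr rfl fun c hc' => by dsimp only; rw [hh' c (mem_range.1 hc')]
  have hext : ∀ i < K, ex m (wN w es) (fun c => (t' i c : ℝ)) = ex m (wN w es) (fun c => (tF n es As o j i c : ℝ)) := by
    intro i hi
    unfold ex
    exact sum_congr rfl fun c hc' => by dsimp only; rw [ht' i hi c (mem_range.1 hc')]
  have hh : 0 ≤ ex m (wN w es) (fun c => (h' c : ℝ)) := by
    rw [hexh, ex_hF_on w es hnd hw hAs o j]; linarith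
  have key := sum_ex_mul_ex_nonneg_of_check hc hw01 hh
  have hcut' : ∀ i ∈ range K, ex m (wN w es) (fun c => (t' i c : ℝ)) ≤ t - L := by
    intro i hi
    rw [mem_range] at hi
    rw [hext i hi, ex_tF_on w es hnd hw hAs o j i]
    have hi' : i < As.length := by omega
    have e1 : As.getD i o = As[i] := by
      rw [List.getD_eq_getElem?_getD, List.getElem?_eq_getElem hi', Option.getD_some]
    have := hcut _ (List.mem_toFinset.2 (e1 ▸ List.getElem_mem hi'))
    linarith
  have hapos : ∀ i, 0 ≤ ex m (wN w es) (fun c => (a i c : ℝ)) := fun i => ex_nonneg _ hw01 fun c => Nat.cast_nonneg _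
  have hΛ : 0 < ∑ i ∈ range K, ex m (wN w es) (fun c => (a i c : ℝ)) := by
    refine lt_of_lt_of_le ?_ (single_le_sum (fun i _ => hapos i) (mem_range.2 hi₀))
    unfold ex
    refine lt_of_lt_of_le ?_ (single_le_sum (fun c _ => mul_nonneg (Nat.cast_nonneg _) (wt_nonneg _ hw01 c)) (mem_range.2 hc₀))
    exact mul_pos (by exact_mod_cast ha₀) (wt_pos_of_lt _ hopen c₀)
  have hsum : ∑ i ∈ range K, ex m (wN w es) (fun c => (t' i c : ℝ)) * ex m (wN w es) (fun c => (a i c : ℝ)) ≤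
      ∑ i ∈ range K, (t - L) * ex m (wN w es) (fun c => (a i c : ℝ)) :=
    sum_le_sum fun i hi => mul_le_mul_of_nonneg_right (hcut' i hi) (hapos i)
  rw [← mul_sum] at hsum
  have h3 : 0 ≤ (t - L) * ∑ i ∈ range K, ex m (wN w es) (fun c => (a i c : ℝ)) := le_trans key hsum
  by_contra hlt
  have h4 : (t - L) * ∑ i ∈ range K, ex m (wN w es) (fun c => (a i c : ℝ)) < 0 :=
    mul_neg_of_neg_of_pos (by linarith) hΛ
  linarith

/-! ## The closed support-cube: `FARp` for every weight function vanishing off the support -/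

/-- The approximating weights: `nudge k` on the pairs of the support, unchanged elsewhere. [this work] -/
noncomputable def nudgeOn {n : ℕ} (es : List (Fin n × Fin n)) (k : ℕ) (w : Sym2 (Fin n) → unitInterval) :
    Sym2 (Fin n) → unitInterval :=
  fun e => if e ∈ Eset es then OneCutCert.nudge k (w e) else w e

/-- The approximating weights still vanish off the support. [this work] -/
theorem vanishesOff_nudgeOn {n : ℕ} (es : List (Fin n × Fin n)) (k : ℕ) (w : Sym2 (Fin n) → unitInterval)
    (hw : VanishesOff w es) : VanishesOff (nudgeOn es k w) es := by
  intro e hd he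
  simp only [nudgeOn, he, if_false]
  exact hw e hd he

/-- The approximating weights converge to `w`. [this work] -/
theorem nudgeOn_tendsto {n : ℕ} (es : List (Fin n × Fin n)) (w : Sym2 (Fin n) → unitInterval) :
    Tendsto (fun k => nudgeOn es k w) atTop (𝓝 w) := by
  rw [tendsto_pi_nhds]
  intro e
  by_cases he : e ∈ Eset es
  · simp only [nudgeOn, he, if_true]; exact OneCutCert.nudge_tendsto (w e)
  · simp only [nudgeOn, he, if_false]; exact tendsto_const_nhds

/-- Eventually every support coordinate of the approximating weights lies in `(0, 1)`. [this work] -/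
theorem nudgeOn_eventually_open {n : ℕ} (es : List (Fin n × Fin n)) (w : Sym2 (Fin n) → unitInterval) :
    ∀ᶠ k in atTop, ∀ i < es.length, 0 < wN (nudgeOn es k w) es i ∧ wN (nudgeOn es k w) es i < 1 := by
  have hall : ∀ᶠ k in atTop, ∀ e : Sym2 (Fin n), ((OneCutCert.nudge k (w e) : ℝ) ≠ 0 ∧
      (OneCutCert.nudge k (w e) : ℝ) ≠ 1 / 2 ∧ (OneCutCert.nudge k (w e) : ℝ) ≠ 1) :=
    Filter.eventually_all.2 fun e => OneCutCert.nudge_eventually_generic (w e)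
  refine hall.mono fun k hk i hi => ?_
  have hmem : mkE (es[i]) ∈ Eset es := by
    unfold Eset
    rw [List.mem_toFinset]
    exact List.mem_map.2 ⟨es[i], List.getElem_mem hi, rfl⟩
  have hwN : wN (nudgeOn es k w) es i = (OneCutCert.nudge k (w (mkE (es[i]))) : ℝ) := by
    unfold wN
    rw [dif_pos hi]
    simp only [nudgeOn, hmem, if_true]
  obtain ⟨h0, -, h1⟩ := hk (mkE (es[i]))
  have hm := (OneCutCert.nudge k (w (mkE (es[i])))).2
  rw [hwN]
  exact ⟨lt_of_le_of_ne hm.1 (Ne.symm h0), lt_of_le_of_ne hm.2 h1⟩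

/-- **`FARp` from a two-copy certificate on a support.**  If the check passes for the FAR tables of `(es, As, o, j)` with a multiplier
`a ≢ 0`, then `FARp w As.toFinset o j` holds for EVERY weight function `w` vanishing off `es` (all sub-supports included: weights
`0`/`1` on `es` are reached by continuity, `FARp.of_limit`). [this work] -/
theorem FARp.of_check_on {n : ℕ} (es : List (Fin n × Fin n)) (hnd : (es.map mkE).Nodup)
    {As : List (Fin n)} (hAs : As.Nodup) (o : Fin n) (j : ℕ) {K : ℕ} (hK : As.length = K)
    {t' : ℕ → ℕ → ℤ} {h' : ℕ → ℤ} {a : ℕ → ℕ → ℕ} {b : ℕ → ℕ}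
    (ht' : ∀ i < K, ∀ c < 2 ^ es.length, t' i c = tF n es As o j i c)
    (hh' : ∀ c < 2 ^ es.length, h' c = hF n es As o j c)
    (hc : twoCopyCheck es.length K t' h' a b = true)
    {i₀ c₀ : ℕ} (hi₀ : i₀ < K) (hc₀ : c₀ < 2 ^ es.length) (ha₀ : 0 < a i₀ c₀)
    (w : Sym2 (Fin n) → unitInterval) (hw : VanishesOff w es) : FARp w As.toFinset o j := by
  refine FARp.of_limit As.toFinset o j w (fun k => nudgeOn es k w) (nudgeOn_tendsto es w) ?_
  refine (nudgeOn_eventually_open es w).mono fun k hk => ?_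
  intro hEN t hcut
  exact farLayer_le_of_check_on es hnd hAs o j hK ht' hh' hc hi₀ hc₀ ha₀ (nudgeOn es k w)
    (vanishesOff_nudgeOn es k w hw) hk (le_of_lt hEN) t hcut

/-! ## Deep relays: the hypothesis-free instances -/

/-- THE DEEP-RELAY CHECK for the `i`-th listed relay `v`: in every configuration of `es` in which `o ↔ v`, at least `j + 1`
listed relays are joined to `o` ("every `o`–`v` path meets `j` other relays"). [this work] -/
def deepCheck (n : ℕ) (es : List (Fin n × Fin n)) (As : List (Fin n)) (o : Fin n) (j i : ℕ) : Bool :=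
  (List.range (2 ^ es.length)).all fun c =>
    !(connB n es c (o : ℕ) ((As.getD i o : Fin n) : ℕ)) || decide (j + 1 ≤ relayCount n es As o c)

/-- **`FARp` from a deep relay, no hypothesis on the mean.**  If `deepCheck` passes for a listed relay then `P(N ≤ j, o ↔ v) = 0`
for every `w` vanishing off `es`, so `P(N ≤ j) ≤ P(o ↮ v) ≤ t`. [this work] -/
theorem FARp.of_deep_on {n : ℕ} (es : List (Fin n × Fin n)) (hnd : (es.map mkE).Nodup)
    {As : List (Fin n)} (hAs : As.Nodup) (o : Fin n) (j i : ℕ) (hi : i < As.length)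
    (hdeep : deepCheck n es As o j i = true)
    (w : Sym2 (Fin n) → unitInterval) (hw : VanishesOff w es) : FARp w As.toFinset o j := by
  classical
  intro _ t hcut
  have hvmem : As.getD i o ∈ As.toFinset := by
    have e1 : As.getD i o = As[i] := by
      rw [List.getD_eq_getElem?_getD, List.getElem?_eq_getElem hi, Option.getD_some]
    rw [e1]
    exact List.mem_toFinset.2 (List.getElem_mem hi)
  set S : Set (Set (Sym2 (Fin n))) := {ω | (As.toFinset.filter fun a => ω ∈ openConn o a).card ≤ j} with hS
  set T : Set (Set (Sym2 (Fin n))) := openConn o (As.getD i o) with hT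
  -- the joint event is null
  have hzero : (prodBernoulli w).real (S ∩ T) = 0 := by
    rw [hS, hT, ← ex_leLayer_conn_on w es hnd hw hAs o (As.getD i o) j]
    unfold ex
    refine sum_eq_zero fun c hc => ?_
    rw [mem_range] at hc
    have hall := List.all_eq_true.1 hdeep c (List.mem_range.2 hc)
    rw [Bool.or_eq_true] at hall
    have hnot : ¬ (relayCount n es As o c ≤ j ∧ connB n es c o (As.getD i o) = true) := by
      rintro ⟨hle, hconn⟩
      rcases hall with h1 | h2
      · rw [hconn] at h1; exact Bool.false_ne_true h1
      · have := of_decide_eq_true h2; omega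
    dsimp only
    rw [if_neg hnot, zero_mul]
  -- split `S` along `o ↔ v`
  have hsplit : (prodBernoulli w).real S ≤ (prodBernoulli w).real (S ∩ T) + (prodBernoulli w).real (S ∩ Tᶜ) := by
    calc (prodBernoulli w).real S = (prodBernoulli w).real (S ∩ T ∪ S ∩ Tᶜ) := by rw [Set.inter_union_compl]
      _ ≤ (prodBernoulli w).real (S ∩ T) + (prodBernoulli w).real (S ∩ Tᶜ) := measureReal_union_le _ _
  rw [hzero, zero_add] at hsplit
  exact hsplit.trans ((measureReal_mono Set.inter_subset_right (measure_ne_top _ _)).trans (hcut _ hvmem))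

end Summit.CriticalPhenomena.PercolationContinuityZ3.Theorems.TwoCopy
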